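/-
Origin: expansion seat `planner-pub-hodgecm-pv13-g6-0`, handover #2 2026-08-18T15:05Z (md5 91f8ed5c424a601dc97d5c16398c11b5, 336 l.; SUPERSEDES the 15:00Z CLAIM md5 4087c367 — split to ≤ 400 l. per the LEAN-IN-TREE rule, §4 moved to row 3; NEW additive leaf; ONE import rewrite `import Pv13g6.GenuineSchrodingerHeisSmooth` ↦ `import HodgeCM.PerL34.GenuineSchrodingerHeisSmooth` (= row #1c 3881e943); land AFTER row #1c; HOLD iff row #1 or pv13-g5 RUN-30 rows 1f97a6 (`HOME/pub-hodgecm-pv13-g6/lean/Pv13g6/GenuineSchrodingerHeisAdmissible.lean`, md5 91f8ed5c, 336 lines);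
landed by the gen-8 packager in gate run 31 as `HodgeCM/PerL34/GenuineSchrodingerHeisAdmissible.lean` (import ^import Pv13g6\.GenuineSchrodingerHeisSmooth[ \t]*$→import HodgeCM.PerL34.GenuineSchrodingerHeisSmooth ×1).
-/
/-
Copyright (c) 2026. All rights reserved.
Released under Apache 2.0 license as described in the file LICENSE.
Authors: unit pub-hodgecm-pv13-g6 (DAG-NODE PROVER #13 gen 6, seam S3, 𝓕-side).

# HodgeCM/PerL34/GenuineSchrodingerHeisAdmissible.lean — ADMISSIBILITY of the adelic Heisenberg–Schrödinger
# representation on `L²(X)`: the level-`k` fixed spaces are finite-dimensional, spanned by the indicators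
# of the level cosets inside the dual ball (sequel: `GenuineSchrodingerHeisFixedDim`, the exact dimension)
-/
import Summits.HodgeConjecture.HodgeCM.PerL34.GenuineSchrodingerHeisSmooth

/-!
# Admissibility of the adelic Heisenberg–Schrödinger representation on `L²(X)`

`X = RestrictedTensorL2.Space L = ∏'_v (L⁺_v)³` (split places `v` of the CM field `L`, base completions),
`μ = μ L` its Haar measure, `B_k = levelBall L k` the level balls (pv13-g5 `GenuineSchrodingerSchwartzDense`),
`τ`, `M_ξ = modulate (heisCharA ψ … ξ)` the translation / modulation operators of the adelic Heisenberg group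
of `X ⊕ X` on `L²(X)` (pv13-g5 `GenuineSchrodingerHeisenberg`), `B_k^⊥ = dualBall ψ hψc hψO k` the dual level
balls and `L²(X)^∞ = heisSmooth ψ hψc hψO` the smooth vectors (this seat's #1 `GenuineSchrodingerHeisSmooth`).

This leaf proves that the representation is ADMISSIBLE — its spaces of fixed vectors under the compact open
subgroups `B_k × B_k` (× centre) are finite-dimensional — and identifies those spaces:

* §1 `cosetInd x k = 1_{x + B_k}`, `cosetSpan T k = span {1_{x + B_k} : x ∈ T}` (finite-dimensional for `T`
  finite) and the KEY step `mem_cosetSpan_of_translate_eq`: a class fixed by `τ(B_k)` and vanishing a.e. off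
  `⋃_{x ∈ t} (x + B_k)` (`t` finite) is a linear combination of the `1_{x + B_k}`, `x ∈ t` (`f = ∑_D P_D f`
  over the distinct cosets, `P_D f = c_D 1_D` by the per-coset Fubini step of #1 §2); indicators of disjoint
  cosets are orthogonal and non-zero (`inner_cosetInd_eq_zero`, `cosetInd_ne_zero`: Haar measure charges
  open sets).
* §2 the FIXED SPACES `heisFixed ψ hψc hψO k = L²(X)^{B_k × B_k} = {f : τ_y f = f, M_ξ f = f ∀ y, ξ ∈ B_k}`:
  increasing in `k`, union `= L²(X)^∞` (`heisSmooth_eq_iSup_heisFixed`), dense in `L²(X)`; and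
  **`finiteDimensional_heisFixed`**: if `B_k^⊥` is compact, `L²(X)^{B_k × B_k}` is finite-dimensional (a
  fixed vector lives a.e. on `B_k^⊥` by #1 `ae_eq_zero_off_dualBall`, so ONE finite level cover of `B_k^⊥`
  spans the whole fixed space, `exists_finset_heisFixed_le_cosetSpan`); for data non-trivial everywhere and
  of order `0` almost everywhere every `B_k^⊥` is compact (#1 `isCompact_dualBall`), whence
  **`finiteDimensional_heisFixed_of_order_zero`** — ADMISSIBILITY.
* §3 for `k ≥ k₀` (`B_k ⊆ B_k^⊥`, `exists_level_levelBall_subset_dualBall`) the indicator `1_{x + B_k}` of a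
  coset of a point `x ∈ B_k^⊥` IS a fixed vector (`cosetInd_mem_heisFixed`: `τ`-invariance by saturation,
  `M_ξ`-invariance because `ψ_𝔸(⟨ξ, ·⟩) ≡ 1` on `x + B_k ⊆ B_k^⊥`), so
  **`heisFixed_eq_cosetSpan_dualBall`**: `L²(X)^{B_k × B_k} = span {1_{x + B_k} : x ∈ B_k^⊥}`.
(The exact dimension `dim L²(X)^{B_k × B_k} = [B_k^⊥ : B_k]` is the sequel leaf `GenuineSchrodingerHeisFixedDim`.)

ABSOLUTE RULE.  Nothing is cited and nothing is posited: every statement is kernel-proved here from this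
seat's #1 `GenuineSchrodingerHeisSmooth` (hence pv13-g5's RUN-30 leaves and the RUN-28 local factors) and
Mathlib.  The only hypotheses are DATA supplied by the caller — the local characters `ψ`, continuity `hψc`,
almost-everywhere unramifiedness `hψO`, and where stated compactness of the dual ball `B_k^⊥` or the
order-`0` normalisation `hψ`, `hψ1` of #1 §9.  No PerL / QW8 / 2001-programme statement appears.

Orientation in print (not used as input): smooth irreducible representations of the Heisenberg group with
given central character are admissible, and the space of vectors fixed by a compact open subgroup of a
Schrödinger model is spanned by characteristic functions of cosets of a lattice — C. Mœglin, M.-F. Vignéras,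
J.-L. Waldspurger, *Correspondances de Howe sur un corps p-adique*, LNM 1291 (1987), ch. 2, I.2–I.6;
A. Weil, *Sur certains groupes d'opérateurs unitaires*, Acta Math. 111 (1964), nos. 11–13; for admissibility
in general: Bernstein–Zelevinsky, *Representations of the group GL(n, F) where F is a non-archimedean local
field*, Russian Math. Surveys 31 (1976), §2.

Namespace `HodgeCM.PerL34.PureTensor.SchrodingerModel.Coeff`; the `ψ`-dependent part is the section
`Characters` with the binders `ψ hψc hψO` of #1 (same shapes, `hψO` included).  WIP import
`Pv13g6.GenuineSchrodingerHeisSmooth` ↦ `HodgeCM.PerL34.GenuineSchrodingerHeisSmooth` (this seat's #1, RUN 31).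
-/

set_option autoImplicit false

noncomputable section

open MeasureTheory MeasureTheory.Measure Set Metric Function Complex Topology Filter
open scoped RestrictedProduct InnerProductSpace NNReal ENNReal Pointwise

namespace HodgeCM.PerL34.PureTensor.SchrodingerModel

open HodgeCM.PerL34.LocalFactors HodgeCM.PerL34.LocalFactors.DilationModel
open HodgeCM.PerL34.LocalFactors.SchrodingerLevi HodgeCM.PerL34.LocalFactors.SchrodingerIrreducible
open HodgeCM.PerL34.IdelePlaces HodgeCM.PerL34.IdelicTorusModel HodgeCM.PerL34.IdelicTorusModel.Genuine
open NumberField IsDedekindDomain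

attribute [local instance] LocalFactors.DilationModel.Adic.nontriviallyNormedField
  LocalFactors.DilationModel.Adic.properSpace

variable {L : Type} [Field L] [NumberField L] [IsCMField L]

namespace Coeff

/-! ## §1  Finite level covers and the span of their coset indicators -/

/-- the indicator `1_{x + B_k}` of a level coset, as an `L²(X)` class -/
def cosetInd (x : Space L) (k : ℕ) : Lp ℂ 2 (μ L) :=
  indCO L (ballCoset L x k) (isCompact_ballCoset x k) (isOpen_ballCoset x k)

/-- a level coset indicator is a Schwartz–Bruhat vector -/
theorem cosetInd_mem_schwartzBruhat (x : Space L) (k : ℕ) : cosetInd x k ∈ schwartzBruhat L :=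
  Submodule.subset_span ⟨⟨ballCoset L x k, isCompact_ballCoset x k, isOpen_ballCoset x k⟩, rfl⟩

/-- the coset indicator only depends on the coset -/
theorem cosetInd_congr {x x' : Space L} {k : ℕ} (h : ballCoset L x k = ballCoset L x' k) :
    cosetInd x k = cosetInd x' k :=
  indCO_congr_set h _ _ _ _

/-- a compact set is covered by the level-`k` cosets through finitely many of its points -/
theorem exists_finset_ballCoset_cover {C : Set (Space L)} (hC : IsCompact C) (k : ℕ) :
    ∃ t : Finset (Space L), (∀ x ∈ t, x ∈ C) ∧ C ⊆ ⋃ x ∈ t, ballCoset L x k :=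
  hC.elim_nhds_subcover (fun x => ballCoset L x k) fun x _ => ballCoset_mem_nhds x k

/-- the span of the coset indicators `1_{x + B_k}`, `x ∈ T` -/
def cosetSpan (T : Set (Space L)) (k : ℕ) : Submodule ℂ (Lp ℂ 2 (μ L)) :=
  Submodule.span ℂ ((fun x => cosetInd x k) '' T)

/-- `cosetSpan` is monotone in the set of points -/
theorem cosetSpan_mono {T T' : Set (Space L)} (h : T ⊆ T') (k : ℕ) : cosetSpan T k ≤ cosetSpan T' k :=
  Submodule.span_mono (Set.image_mono h)

/-- coset spans consist of Schwartz–Bruhat vectors -/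
theorem cosetSpan_le_schwartzBruhat (T : Set (Space L)) (k : ℕ) : cosetSpan T k ≤ schwartzBruhat L :=
  Submodule.span_le.2 (by rintro _ ⟨x, -, rfl⟩; exact cosetInd_mem_schwartzBruhat x k)

/-- the span of finitely many coset indicators is finite-dimensional -/
instance finiteDimensional_cosetSpan (t : Finset (Space L)) (k : ℕ) :
    FiniteDimensional ℂ (cosetSpan (t : Set (Space L)) k) :=
  FiniteDimensional.span_of_finite ℂ ((t.finite_toSet).image _)

/-- **KEY** — a class fixed by `τ(B_k)` and vanishing a.e. off `⋃_{x ∈ t} (x + B_k)` is a linear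
combination of the `1_{x + B_k}`, `x ∈ t`: `f = ∑_D P_D f` over the distinct cosets `D` and
`P_D f = c_D • 1_D` (the per-coset Fubini step of `GenuineSchrodingerHeisSmooth` §2). -/
theorem mem_cosetSpan_of_translate_eq {f : Lp ℂ 2 (μ L)} {k : ℕ} {t : Finset (Space L)}
    (hτ : ∀ y ∈ levelBall L k, translate (μ L) y f = f)
    (hsupp : ∀ᵐ u ∂(μ L), u ∉ (⋃ x ∈ t, ballCoset L x k) → f u = 0) :
    f ∈ cosetSpan (t : Set (Space L)) k := by
  classical
  set 𝒟 : Finset (Set (Space L)) := t.image fun x => ballCoset L x k with h𝒟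
  have h𝒟mem : ∀ D ∈ 𝒟, ∃ x ∈ t, D = ballCoset L x k := fun D hD => by
    obtain ⟨x, hx, rfl⟩ := Finset.mem_image.1 hD
    exact ⟨x, hx, rfl⟩
  have hDm : ∀ D ∈ 𝒟, MeasurableSet D := fun D hD => by
    obtain ⟨x, -, rfl⟩ := h𝒟mem D hD
    exact (isOpen_ballCoset x k).measurableSet
  let piece : Set (Space L) → Lp ℂ 2 (μ L) := fun D =>
    if hD : MeasurableSet D then proj (μ L) hD f else 0
  have hpiece_def : ∀ D (hD : D ∈ 𝒟), piece D = proj (μ L) (hDm D hD) f := fun D hD => dif_pos (hDm D hD)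
  have hpiece : ∀ D ∈ 𝒟, piece D ∈ cosetSpan (t : Set (Space L)) k := fun D hD => by
    obtain ⟨x, hx, rfl⟩ := h𝒟mem D hD
    rw [hpiece_def _ hD]
    obtain ⟨c, hc⟩ := exists_proj_ballCoset_eq_smul_indCO x hτ
    rw [hc]
    exact Submodule.smul_mem _ c (Submodule.subset_span ⟨x, Finset.mem_coe.2 hx, rfl⟩)
  have hsum : f = ∑ D ∈ 𝒟, piece D := by
    apply Lp.ext
    have hall : ∀ᵐ u ∂(μ L), ∀ D ∈ 𝒟, (piece D : Space L → ℂ) u = D.indicator (f : Space L → ℂ) u :=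
      (Filter.eventually_all_finset 𝒟).2 fun D hD => by
        rw [hpiece_def D hD]
        exact coeFn_proj (μ L) (hDm D hD) f
    filter_upwards [hall, hsupp, coeFn_finset_sum_Lp 𝒟 piece] with u hu hu0 hs
    rw [hs]
    by_cases huC : u ∈ ⋃ x ∈ t, ballCoset L x k
    · obtain ⟨x, hxt, hux⟩ := Set.mem_iUnion₂.1 huC
      have hD₀ : ballCoset L x k ∈ 𝒟 := Finset.mem_image.2 ⟨x, hxt, rfl⟩
      rw [Finset.sum_eq_single_of_mem (ballCoset L x k) hD₀ fun D hD hne => ?_]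
      · rw [hu _ hD₀, Set.indicator_of_mem hux]
      · rw [hu D hD, Set.indicator_of_notMem]
        intro huD
        obtain ⟨x', -, rfl⟩ := h𝒟mem D hD
        exact hne (ballCoset_eq_ballCoset_of_mem_of_mem huD hux)
    · have hfu : (f : Space L → ℂ) u = 0 := hu0 huC
      rw [Finset.sum_eq_zero fun D hD => ?_]
      · exact hfu
      · rw [hu D hD, Set.indicator_apply]
        split_ifs
        · exact hfu
        · rfl
  rw [hsum]
  exact Submodule.sum_mem _ hpiece

/-- hence: `τ(B_k)`-fixed and a.e. zero off a compact `C` ⇒ `f` lies in the span of the `1_{x + B_k}` over a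
FINITE set of points `x ∈ C` -/
theorem exists_finset_mem_cosetSpan {f : Lp ℂ 2 (μ L)} {k : ℕ}
    (hτ : ∀ y ∈ levelBall L k, translate (μ L) y f = f)
    {C : Set (Space L)} (hC : IsCompact C) (hsupp : ∀ᵐ u ∂(μ L), u ∉ C → f u = 0) :
    ∃ t : Finset (Space L), (∀ x ∈ t, x ∈ C) ∧ f ∈ cosetSpan (t : Set (Space L)) k := by
  obtain ⟨t, htC, hcover⟩ := exists_finset_ballCoset_cover hC k
  refine ⟨t, htC, mem_cosetSpan_of_translate_eq hτ ?_⟩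
  filter_upwards [hsupp] with u hu huU
  exact hu fun h => huU (hcover h)

/-- indicators of disjoint level cosets are orthogonal in `L²(X)` -/
theorem inner_cosetInd_eq_zero {x x' : Space L} {k : ℕ} (h : ballCoset L x k ∩ ballCoset L x' k = ∅) :
    ⟪cosetInd x k, cosetInd x' k⟫_ℂ = 0 := by
  unfold cosetInd indCO
  rw [L2.inner_indicatorConstLp_eq_inner_setIntegral,
    setIntegral_indicatorConstLp (isOpen_ballCoset x k).measurableSet, Set.inter_comm, h,
    measureReal_def, measure_empty, ENNReal.toReal_zero, zero_smul, inner_zero_right]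

/-- a level coset indicator is a non-zero class (Haar measure charges open sets) -/
theorem cosetInd_ne_zero (x : Space L) (k : ℕ) : cosetInd x k ≠ 0 := by
  intro h0
  have hpos : 0 < (μ L).real (ballCoset L x k) :=
    ENNReal.toReal_pos ((isOpen_ballCoset x k).measure_pos (μ L) ⟨x, mem_ballCoset_self x k⟩).ne'
      (isCompact_ballCoset x k).measure_lt_top.ne
  have h1 : ‖cosetInd x k‖ = (μ L).real (ballCoset L x k) ^ (1 / (2 : ℝ≥0∞).toReal) := by
    unfold cosetInd indCO
    rw [norm_indicatorConstLp (by norm_num) (by norm_num), norm_one, one_mul]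
  rw [h0, norm_zero] at h1
  exact (Real.rpow_pos_of_pos hpos _).ne' h1.symm

/-- level cosets that meet coincide, so the cosets of two points NOT congruent modulo `B_k` are disjoint -/
theorem ballCoset_inter_eq_empty {x x' : Space L} {k : ℕ} (h : x - x' ∉ levelBall L k) :
    ballCoset L x k ∩ ballCoset L x' k = ∅ := by
  refine Set.eq_empty_iff_forall_notMem.2 fun u ⟨hu, hu'⟩ => h ?_
  have he := ballCoset_eq_ballCoset_of_mem_of_mem hu hu'
  exact mem_ballCoset_iff_sub_mem.1 (he ▸ mem_ballCoset_self x k : x ∈ ballCoset L x' k)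

/-! ## §2  The level-`k` fixed spaces `L²(X)^{B_k × B_k}` of the Heisenberg–Schrödinger representation -/

section Characters

variable (ψ : ∀ i : SplitIdx L, AddChar ((basePlaceOf L i.1).adicCompletion (maximalRealSubfield L)) Circle)
variable (hψc : ∀ i, Continuous (ψ i))
variable (hψO : ∀ᶠ i : SplitIdx L in cofinite,
  ∀ t : (basePlaceOf L i.1).adicCompletion (maximalRealSubfield L), ‖t‖ ≤ 1 → ψ i t = 1)
include hψO

/-- **the level-`k` fixed space** `L²(X)^{B_k × B_k} = {f : τ_y f = f, M_ξ f = f for all y, ξ ∈ B_k}` of the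
compact open subgroup `B_k × B_k` (× centre) of the adelic Heisenberg group. -/
def heisFixed (k : ℕ) : Submodule ℂ (Lp ℂ 2 (μ L)) where
  carrier := {f | (∀ y ∈ levelBall L k, translate (μ L) y f = f) ∧
    ∀ ξ ∈ levelBall L k, modulate (μ L) (heisCharA ψ hψc hψO ξ) f = f}
  zero_mem' := ⟨fun y _ => map_zero _, fun ξ _ => map_zero _⟩
  add_mem' := by
    rintro f f' ⟨hk, hkM⟩ ⟨hk', hkM'⟩
    exact ⟨fun y hy => by rw [map_add, hk y hy, hk' y hy], fun ξ hξ => by rw [map_add, hkM ξ hξ, hkM' ξ hξ]⟩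
  smul_mem' := by
    rintro c f ⟨hk, hkM⟩
    exact ⟨fun y hy => by rw [map_smul, hk y hy], fun ξ hξ => by rw [map_smul, hkM ξ hξ]⟩

/-- membership in the level-`k` fixed space, unfolded -/
theorem mem_heisFixed_iff {k : ℕ} {f : Lp ℂ 2 (μ L)} :
    f ∈ heisFixed ψ hψc hψO k ↔ (∀ y ∈ levelBall L k, translate (μ L) y f = f) ∧
      ∀ ξ ∈ levelBall L k, modulate (μ L) (heisCharA ψ hψc hψO ξ) f = f :=
  Iff.rfl

/-- the fixed spaces increase with the level -/
theorem heisFixed_mono : Monotone (heisFixed ψ hψc hψO) := by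
  rintro k k' hkk' f ⟨hk, hkM⟩
  exact ⟨fun y hy => hk y (levelBall_antitone L hkk' hy), fun ξ hξ => hkM ξ (levelBall_antitone L hkk' hξ)⟩

/-- the smooth vectors are the union of the fixed spaces: `L²(X)^∞ = ⋃_k L²(X)^{B_k × B_k}` -/
theorem mem_heisSmooth_iff_exists_mem_heisFixed {f : Lp ℂ 2 (μ L)} :
    f ∈ heisSmooth ψ hψc hψO ↔ ∃ k, f ∈ heisFixed ψ hψc hψO k :=
  Iff.rfl

/-- every fixed space consists of smooth vectors -/
theorem heisFixed_le_heisSmooth (k : ℕ) : heisFixed ψ hψc hψO k ≤ heisSmooth ψ hψc hψO :=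
  fun _ hf => ⟨k, hf⟩

/-- `L²(X)^∞ = ⨆_k L²(X)^{B_k × B_k}` as submodules -/
theorem heisSmooth_eq_iSup_heisFixed : heisSmooth ψ hψc hψO = ⨆ k, heisFixed ψ hψc hψO k := by
  refine le_antisymm (fun f hf => ?_) (iSup_le (heisFixed_le_heisSmooth ψ hψc hψO))
  obtain ⟨k, hk⟩ := hf
  exact Submodule.mem_iSup_of_mem k hk

/-- the smooth vectors are dense in `L²(X)` (they contain the dense `𝒮(X)`) -/
theorem dense_heisSmooth : Dense (heisSmooth ψ hψc hψO : Set (Lp ℂ 2 (μ L))) :=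
  (dense_schwartzBruhat (L := L)).mono (schwartzBruhat_le_heisSmooth ψ hψc hψO)

/-- a fixed vector is a linear combination of finitely many coset indicators `1_{x + B_k}`, `x ∈ B_k^⊥` —
provided the dual ball `B_k^⊥` is compact -/
theorem exists_finset_heisFixed_mem_cosetSpan {k : ℕ} (hcpt : IsCompact (dualBall ψ hψc hψO k : Set (Space L)))
    {f : Lp ℂ 2 (μ L)} (hf : f ∈ heisFixed ψ hψc hψO k) :
    ∃ t : Finset (Space L), (∀ x ∈ t, x ∈ dualBall ψ hψc hψO k) ∧ f ∈ cosetSpan (t : Set (Space L)) k :=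
  exists_finset_mem_cosetSpan hf.1 hcpt (ae_eq_zero_off_dualBall ψ hψc hψO hf.2)

/-- **the fixed space lies in the span of the coset indicators through ONE finite subset of `B_k^⊥`**
(compact dual ball): a finite level cover of `B_k^⊥` serves every fixed vector at once. -/
theorem exists_finset_heisFixed_le_cosetSpan {k : ℕ}
    (hcpt : IsCompact (dualBall ψ hψc hψO k : Set (Space L))) :
    ∃ t : Finset (Space L), (∀ x ∈ t, x ∈ dualBall ψ hψc hψO k) ∧
      heisFixed ψ hψc hψO k ≤ cosetSpan (t : Set (Space L)) k := by
  obtain ⟨t, htC, hcover⟩ := exists_finset_ballCoset_cover hcpt k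
  refine ⟨t, htC, fun f hf => mem_cosetSpan_of_translate_eq hf.1 ?_⟩
  filter_upwards [ae_eq_zero_off_dualBall ψ hψc hψO hf.2] with u hu huU
  exact hu fun h => huU (hcover h)

/-- **ADMISSIBILITY (compact dual ball)**: the level-`k` fixed space is finite-dimensional. -/
theorem finiteDimensional_heisFixed {k : ℕ} (hcpt : IsCompact (dualBall ψ hψc hψO k : Set (Space L))) :
    FiniteDimensional ℂ (heisFixed ψ hψc hψO k) := by
  obtain ⟨t, -, hle⟩ := exists_finset_heisFixed_le_cosetSpan ψ hψc hψO hcpt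
  exact Submodule.finiteDimensional_of_le hle

/-- **ADMISSIBILITY of the adelic Heisenberg–Schrödinger representation on `L²(X)`** for character data
non-trivial at every place and of order `0` at almost every place: every level-`k` fixed space
`L²(X)^{B_k × B_k}` is finite-dimensional (and `L²(X)^∞ = 𝒮(X)` is their increasing union). -/
theorem finiteDimensional_heisFixed_of_order_zero (hψ : ∀ i, ∃ t, ψ i t ≠ 1)
    (hψ1 : ∀ᶠ i : SplitIdx L in cofinite, ∀ t, ψ i t = 1 → ‖t‖ ≤ 1) (k : ℕ) :
    FiniteDimensional ℂ (heisFixed ψ hψc hψO k) :=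
  finiteDimensional_heisFixed ψ hψc hψO (isCompact_dualBall ψ hψc hψO hψ hψ1 k)

/-- the fixed spaces consist of Schwartz–Bruhat vectors (compact dual ball) -/
theorem heisFixed_le_schwartzBruhat {k : ℕ} (hcpt : IsCompact (dualBall ψ hψc hψO k : Set (Space L))) :
    heisFixed ψ hψc hψO k ≤ schwartzBruhat L := by
  obtain ⟨t, -, hle⟩ := exists_finset_heisFixed_le_cosetSpan ψ hψc hψO hcpt
  exact hle.trans (cosetSpan_le_schwartzBruhat _ k)

/-! ## §3  The fixed space for `k ≥ k₀`: exactly the span of the `1_{x + B_k}`, `x ∈ B_k^⊥` -/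

/-- the self-duality level: `B_k ⊆ B_k^⊥` for `k ≥ k₀` (`∏_v 𝒪_v³ ⊆ B_{k₀}^⊥`, `B_k ⊆ ∏_v 𝒪_v³`) -/
theorem exists_level_levelBall_subset_dualBall :
    ∃ k₀, ∀ k, k₀ ≤ k → (levelBall L k : Set (Space L)) ⊆ (dualBall ψ hψc hψO k : Set (Space L)) := by
  obtain ⟨k₀, hk₀⟩ := exists_box_subset_dualBall ψ hψc hψO
  exact ⟨k₀, fun k hk u hu => dualBall_mono ψ hψc hψO hk (hk₀ (levelBall_subset_box L k hu))⟩

/-- for `B_k ⊆ B_k^⊥` and `x ∈ B_k^⊥`, the indicator `1_{x + B_k}` is a fixed vector -/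
theorem cosetInd_mem_heisFixed {k : ℕ}
    (hk : (levelBall L k : Set (Space L)) ⊆ (dualBall ψ hψc hψO k : Set (Space L)))
    {x : Space L} (hx : x ∈ dualBall ψ hψc hψO k) : cosetInd x k ∈ heisFixed ψ hψc hψO k := by
  refine ⟨fun y hy => ?_, fun ξ hξ => ?_⟩
  · exact translate_indCO_of_saturate (isCompact_ballCoset x k) (isOpen_ballCoset x k)
      (fun a ha y' hy' => by
        rw [mem_ballCoset_iff_sub_mem] at ha ⊢
        rw [add_sub_right_comm]
        exact (levelBall L k).add_mem ha hy') hy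
  · refine modulate_indCO_of_eq_one ψ hψc hψO (isCompact_ballCoset x k) (isOpen_ballCoset x k) fun u hu => ?_
    obtain ⟨v, hv, rfl⟩ := hu
    rw [heisPairing_add_right ψ hψc hψO, hx ξ hξ, (hk hv) ξ hξ, one_mul]

/-- **the fixed space for `B_k ⊆ B_k^⊥` compact**: `L²(X)^{B_k × B_k} = span {1_{x + B_k} : x ∈ B_k^⊥}`. -/
theorem heisFixed_eq_cosetSpan_dualBall {k : ℕ} (hcpt : IsCompact (dualBall ψ hψc hψO k : Set (Space L)))
    (hk : (levelBall L k : Set (Space L)) ⊆ (dualBall ψ hψc hψO k : Set (Space L))) :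
    heisFixed ψ hψc hψO k = cosetSpan (dualBall ψ hψc hψO k : Set (Space L)) k := by
  refine le_antisymm (fun f hf => ?_) (Submodule.span_le.2 ?_)
  · obtain ⟨t, ht, hle⟩ := exists_finset_heisFixed_le_cosetSpan ψ hψc hψO hcpt
    exact cosetSpan_mono (fun x hx => ht x (Finset.mem_coe.1 hx)) k (hle hf)
  · rintro _ ⟨x, hx, rfl⟩
    exact cosetInd_mem_heisFixed ψ hψc hψO hk hx

end Characters

end Coeff

end HodgeCM.PerL34.PureTensor.SchrodingerModel
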